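/-
Copyright (c) 2026. All rights reserved.
Released under Apache 2.0 license as described in the file LICENSE.
Authors: abc-iut cell, prover seat abc-iut-w5-d014 (wave 5, gen 4).
-/
import Literature.IUT.LogVolume.UnitLogUnramifiedDyadicArtinSchreier
import HarnessLib

/-!
# Unramified dyadic fields: the unit stabiliser of `log₂(𝒪_K^×)` is `1 + 2·𝒪_K`

Proof-only companion (theorems, no definitions, no named facts) of `UnitLogUnramifiedDyadicArtinSchreier.lean`
(`log₂(𝒪_K^×) = 2·℘(𝒪_K) + 4·𝒪_K` for an absolutely unramified complete proper ultrametric normed `ℚ₂`-field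
`K`, `℘(a) = a² + a`) and of abc-iut-w5-d180's `UnitLogUnramifiedDyadic.lean`.

* `eq_zero_or_eq_one_of_mul_artinSchreier` — over a finite field `k` of characteristic `2`, **the multiplier
  of `℘(k)` in `k` is `𝔽₂`**: if `a·℘(b) ∈ ℘(k)` for all `b` then `a ∈ {0, 1}` (write `a = α²`;
  `a·℘(b) + ℘(αb) = (α² + α)·b`, so `(α² + α)·k ⊆ ℘(k) ≠ k` — `℘(0) = ℘(1)` — forces `α² + α = 0`);
* **`smul_logUnits_eq_iff_norm_sub_one_lt`** — for `‖u‖ = 1`: `u·log₂(𝒪^×) = log₂(𝒪^×) ↔ ‖u − 1‖ < 1`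
  (every `f`; `⇐`: `(u − 1)·log₂(𝒪^×) ⊆ 2𝒪·2𝒪 = 4𝒪 ⊆ log₂(𝒪^×)`; `⇒`: the residue `ū` multiplies `℘(k)` into
  itself); `smul_smul_logUnits_eq_iff_norm_sub_one_lt` — the same for every non-zero multiple `c·log₂(𝒪^×)`,
  e.g. the log-shell `ℐ = 4⁻¹·log₂(𝒪^×)` of [AbsTopIII] Def. 5.4 (iii);
* `exists_unit_smul_logUnits_ne` — `f ≥ 2` ⇒ some unit (any `u` with `ū ∉ 𝔽₂`) MOVES `log₂(𝒪^×)`, although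
  multiplication by a unit fixes every ball.

Consumers (not imported, not restated): the cell's TEAM R «`ismDH` mover» thread — abc-iut-w5-d039's
`Summit.ABC.IUTFork.Thm311.Real.forall_ismDH_image_smul_shell_iff` (p433488: a shell multiple `c·ℐ_v` is
(Ind2)-stable iff `c·ℐ_v = p^k·ℐ_v`) and abc-iut-w5-d180's ball criterion: at an unramified dyadic place with
`f(v|2) ≥ 2` a UNIT multiple `u·ℐ_v` is stable iff `u ≡ 1 (mod 2)`.  Classical (Neukirch II (5.5); Artin–Schreier
theory of `𝔽_{2^f}`); nothing here is disputed mathematics, no IUT statement is asserted, nothing bears on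
which reading of [IUTchIII] is print's.

References: [cite: NeukirchANT1999, Ch. II Prop. (5.5)] · [cite: MochizukiAbsTopIII2015, Def. 5.4 (iii) p. 126].
-/

noncomputable section

open Metric Set IsLocalRing
open scoped Pointwise

namespace Literature.IUT.LogVolume

namespace UnramifiedDyadic

open Literature.NumberTheory.GaloisRepresentations.Ultrametric

variable {K : Type*} [NontriviallyNormedField K] [instK : NormedAlgebra ℚ_[2] K]

variable [IsUltrametricDist K] [CompleteSpace K] [ProperSpace K]

section Residue

open scoped NormedField

/-! ## 1. The multiplier of `℘(k)` in a finite field `k` of characteristic `2` is `𝔽₂` -/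

section ArtinSchreier

variable {k : Type*} [Field k] [CharP k 2]

omit instK [IsUltrametricDist K] [CompleteSpace K] [ProperSpace K] in
/-- `℘(b) = 0 ↔ b ∈ 𝔽₂` (the kernel of the Artin–Schreier map is the prime field).
[cite: LidlNiederreiter1996, Chapter 2, §3, Theorem 2.25] -/
theorem artinSchreier_eq_zero_iff (b : k) : b ^ 2 + b = 0 ↔ b = 0 ∨ b = 1 := by
  rw [show b ^ 2 + b = b * (b + 1) by ring, mul_eq_zero, add_eq_zero_iff_eq_neg, CharTwo.neg_eq]

omit instK [IsUltrametricDist K] [CompleteSpace K] [ProperSpace K] in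
/-- `℘` is additive (`(b + c)² = b² + c²` in characteristic `2`). [cite: LidlNiederreiter1996, Chapter 2, §3, Theorem 2.25] -/
theorem artinSchreier_add (b c : k) : (b + c) ^ 2 + (b + c) = (b ^ 2 + b) + (c ^ 2 + c) := by
  rw [CharTwo.add_sq]; ring

omit instK [IsUltrametricDist K] [CompleteSpace K] [ProperSpace K] in
/-- On a finite field of characteristic `2`, `℘` is not onto (`℘(0) = ℘(1)`; its image is the kernel of the absolute
trace, a hyperplane). [cite: LidlNiederreiter1996, Chapter 2, §3, Theorem 2.25] -/
theorem exists_ne_artinSchreier [Finite k] : ∃ c : k, ∀ b : k, b ^ 2 + b ≠ c := by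
  by_contra h
  push Not at h
  have hsurj : Function.Surjective fun b : k => b ^ 2 + b := fun c => h c
  have hinj : Function.Injective fun b : k => b ^ 2 + b := Finite.injective_iff_surjective.mpr hsurj
  have h01 : (fun b : k => b ^ 2 + b) 0 = (fun b : k => b ^ 2 + b) 1 := by
    simp [CharTwo.add_self_eq_zero]
  exact zero_ne_one (hinj h01)

omit instK [IsUltrametricDist K] [CompleteSpace K] [ProperSpace K] in
/-- On a finite field of characteristic `2`, Frobenius is onto (an automorphism).
[cite: LidlNiederreiter1996, Chapter 2, §3, Theorem 2.21] -/
theorem exists_sq_eq [Finite k] (a : k) : ∃ α : k, α ^ 2 = a :=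
  Finite.injective_iff_surjective.mp CharTwo.sq_injective a

omit instK [IsUltrametricDist K] [CompleteSpace K] [ProperSpace K] in
/-- **The multiplier of `℘(k)` is `𝔽₂`**: if `a·℘(b) ∈ ℘(k)` for every `b` then `a ∈ {0, 1}` (write `a = α²`;
`a·℘(b) + ℘(αb) = (α² + α)·b`, so `(α² + α)·k ⊆ ℘(k) ≠ k`). [cite: LidlNiederreiter1996, Chapter 2, §3, Theorem 2.25] -/
theorem eq_zero_or_eq_one_of_mul_artinSchreier [Finite k] {a : k}
    (h : ∀ b : k, ∃ c : k, a * (b ^ 2 + b) = c ^ 2 + c) : a = 0 ∨ a = 1 := by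
  obtain ⟨α, rfl⟩ := exists_sq_eq a
  have hα : ∀ b : k, ∃ d : k, (α ^ 2 + α) * b = d ^ 2 + d := fun b => by
    obtain ⟨c, hc⟩ := h b
    refine ⟨c + α * b, ?_⟩
    rw [artinSchreier_add, ← hc]
    have h2 : (2 : k) = 0 := CharTwo.two_eq_zero
    linear_combination (-(α ^ 2 * b ^ 2)) * h2
  obtain ⟨c₀, hc₀⟩ := exists_ne_artinSchreier (k := k)
  have hzero : α ^ 2 + α = 0 := by
    by_contra hne
    obtain ⟨d, hd⟩ := hα ((α ^ 2 + α)⁻¹ * c₀)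
    rw [mul_inv_cancel_left₀ hne] at hd
    exact hc₀ d hd.symm
  rcases (artinSchreier_eq_zero_iff α).mp hzero with h0 | h1
  · left; rw [h0]; ring
  · right; rw [h1]; ring

end ArtinSchreier

/-! ## 2. The unit stabiliser of `log₂(𝒪^×)` is `1 + 2𝒪` -/

omit [CompleteSpace K] in
/-- Principal units stabilise `log₂(𝒪^×)`: `‖u − 1‖ < 1 ⇒ u·log₂(𝒪^×) ⊆ log₂(𝒪^×)`
(`uℓ = ℓ + (u − 1)ℓ` with `(u − 1)ℓ ∈ 2𝒪·2𝒪 = 4𝒪 ⊆ log₂(𝒪^×)`). [cite: NeukirchANT1999, Ch. II Prop. (5.5)] -/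
theorem smul_logUnits_subset_of_norm_sub_one_lt (he : absRamificationIdx 2 K = 1) {u : K}
    (hu : ‖u - 1‖ < 1) : u • logUnits K ⊆ logUnits K := by
  rintro _ ⟨ℓ, hℓ, rfl⟩
  have hℓ2 : ‖ℓ‖ ≤ 2⁻¹ := by
    have h := logUnits_subset_closedBall_two he hℓ
    rwa [mem_closedBall, dist_zero_right, WildDyadic.norm_two] at h
  have ht : ‖(u - 1) * ℓ‖ ≤ ‖(4 : K)‖ := by
    rw [norm_mul, norm_four]
    calc ‖u - 1‖ * ‖ℓ‖ ≤ 2⁻¹ * 2⁻¹ := by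
          gcongr
          exact norm_le_half_of_norm_lt_one he hu
      _ = 4⁻¹ := by norm_num
  have hmem := add_mem_logUnits_of_norm_le hℓ ht
  rwa [show ℓ + (u - 1) * ℓ = u • ℓ by rw [smul_eq_mul]; ring] at hmem

omit [CompleteSpace K] in
/-- Principal units stabilise `log₂(𝒪^×)`: `‖u − 1‖ < 1 ⇒ u·log₂(𝒪^×) = log₂(𝒪^×)`.
[cite: NeukirchANT1999, Ch. II Prop. (5.5)] -/
theorem smul_logUnits_eq_of_norm_sub_one_lt (he : absRamificationIdx 2 K = 1) {u : K}
    (hu : ‖u - 1‖ < 1) : u • logUnits K = logUnits K := by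
  have hu1 : ‖u‖ = 1 := by
    have h : IsPrincipal u := by rw [isPrincipal_iff, norm_sub_rev]; exact hu
    exact h.norm_eq_one
  have hu0 : u ≠ 0 := norm_pos_iff.mp (by rw [hu1]; exact one_pos)
  have hinv : ‖u⁻¹ - 1‖ < 1 := by
    rw [show u⁻¹ - 1 = u⁻¹ * (1 - u) by rw [mul_sub, mul_one, inv_mul_cancel₀ hu0], norm_mul, norm_inv,
      hu1, inv_one, one_mul, norm_sub_rev]
    exact hu
  refine Subset.antisymm (smul_logUnits_subset_of_norm_sub_one_lt he hu) fun ℓ hℓ => ?_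
  refine ⟨u⁻¹ • ℓ, smul_logUnits_subset_of_norm_sub_one_lt he hinv ⟨ℓ, hℓ, rfl⟩, ?_⟩
  show u • (u⁻¹ • ℓ) = ℓ
  rw [smul_smul, mul_inv_cancel₀ hu0, one_smul]

/-- **A unit NOT `≡ 1 (mod 2)` moves `log₂(𝒪^×)`**: for `‖u‖ = 1`, `u·log₂(𝒪^×) ⊆ log₂(𝒪^×) ⇒ ‖u − 1‖ < 1`
(the residue `ū` multiplies `℘(k)` into itself, hence `ū ∈ 𝔽₂`, `ū ≠ 0`). [cite: NeukirchANT1999, Ch. II Prop. (5.5)] -/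
theorem norm_sub_one_lt_of_smul_logUnits_subset (he : absRamificationIdx 2 K = 1) {u : K} (hu : ‖u‖ = 1)
    (h : u • logUnits K ⊆ logUnits K) : ‖u - 1‖ < 1 := by
  haveI := finite_residueField (F := K)
  haveI := charP_residueField 2 K
  set u' : Valued.integer K := ⟨u, Valued.integer.mem_iff.mpr hu.le⟩ with hu'
  have ha0 : residue (Valued.integer K) u' ≠ 0 := (norm_eq_one_iff_residue_ne_zero u').mp hu
  -- `ū · ℘(b) ∈ ℘(k)` for every `b`
  have hmul : ∀ b : ResidueField (Valued.integer K), ∃ c,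
      residue (Valued.integer K) u' * (b ^ 2 + b) = c ^ 2 + c := fun b => by
    obtain ⟨x, rfl⟩ := residue_surjective b
    have hx : ‖(x : K)‖ ≤ 1 := Valued.integer.norm_le_one x
    have hw : u * (2 * ((x : K) + (x : K) ^ 2)) ∈ logUnits K :=
      h ⟨_, two_mul_artinSchreier_mem_logUnits he hx, rfl⟩
    have hw' : 2 * (((u' * (x + x ^ 2) : Valued.integer K)) : K) ∈ logUnits K := by
      push_cast
      rw [show (2 : K) * (u * ((x : K) + (x : K) ^ 2)) = u * (2 * ((x : K) + (x : K) ^ 2)) by ring]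
      exact hw
    obtain ⟨c, hc⟩ := (two_mul_mem_logUnits_iff_residue he _).mp hw'
    refine ⟨c, ?_⟩
    rw [← hc, map_mul, map_add, map_pow]
    ring
  have ha : residue (Valued.integer K) u' = 1 := by
    rcases eq_zero_or_eq_one_of_mul_artinSchreier hmul with h0 | h1
    · exact absurd h0 ha0
    · exact h1
  have hfin : ‖((u' : Valued.integer K) : K) - ((1 : Valued.integer K) : K)‖ < 1 := by
    rw [← residue_eq_iff_norm_sub_lt_one, ha, map_one]
  simpa [hu'] using hfin

/-- **The unit stabiliser of `log₂(𝒪_K^×)` is `1 + 2𝒪_K`** (`K/ℚ₂` unramified, any `f`): for `‖u‖ = 1`,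
`u·log₂(𝒪^×) = log₂(𝒪^×) ↔ ‖u − 1‖ < 1`. (For `f = 1` both sides always hold; for `f ≥ 2` the units with
`ū ∉ 𝔽₂` move the log-shell.) [cite: NeukirchANT1999, Ch. II Prop. (5.5)] -/
theorem smul_logUnits_eq_iff_norm_sub_one_lt (he : absRamificationIdx 2 K = 1) {u : K} (hu : ‖u‖ = 1) :
    u • logUnits K = logUnits K ↔ ‖u - 1‖ < 1 :=
  ⟨fun h => norm_sub_one_lt_of_smul_logUnits_subset he hu h.le,
    smul_logUnits_eq_of_norm_sub_one_lt he⟩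

/-- The same for any non-zero multiple `c·log₂(𝒪^×)` of the shell (e.g. the log-shell `ℐ = 4⁻¹·log₂(𝒪^×)`):
`u·(c·log₂(𝒪^×)) = c·log₂(𝒪^×) ↔ ‖u − 1‖ < 1`. [cite: MochizukiAbsTopIII2015, Def. 5.4 (iii) p. 126] -/
theorem smul_smul_logUnits_eq_iff_norm_sub_one_lt (he : absRamificationIdx 2 K = 1) {c : K} (hc : c ≠ 0)
    {u : K} (hu : ‖u‖ = 1) : u • (c • logUnits K) = c • logUnits K ↔ ‖u - 1‖ < 1 := by
  rw [← smul_logUnits_eq_iff_norm_sub_one_lt he hu, smul_comm u c (logUnits K)]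
  constructor
  · intro h
    have h' := congrArg (fun S : Set K => c⁻¹ • S) h
    simpa only [smul_smul, ← mul_assoc, inv_mul_cancel₀ hc, one_mul, one_smul] using h'
  · intro h
    rw [h]

/-- **`f ≥ 2` ⇒ some unit moves `log₂(𝒪_K^×)`** (any `u` with `ū ∉ 𝔽₂`). [cite: NeukirchANT1999, Ch. II Prop. (5.5)] -/
theorem exists_unit_smul_logUnits_ne (he : absRamificationIdx 2 K = 1) (hf : 2 ≤ residueDegree 2 K) :
    ∃ u : K, ‖u‖ = 1 ∧ u • logUnits K ≠ logUnits K := by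
  obtain ⟨a, ha0, ha1⟩ := exists_ne_zero_ne_one_residueField hf
  obtain ⟨x, rfl⟩ := residue_surjective a
  have hu : ‖(x : K)‖ = 1 := (norm_eq_one_iff_residue_ne_zero x).mpr ha0
  refine ⟨(x : K), hu, fun h => ha1 ?_⟩
  have h1 : ‖(x : K) - 1‖ < 1 := (smul_logUnits_eq_iff_norm_sub_one_lt he hu).mp h
  have h2 : ‖((x : Valued.integer K) : K) - ((1 : Valued.integer K) : K)‖ < 1 := by simpa using h1
  rw [← residue_eq_iff_norm_sub_lt_one, map_one] at h2
  exact h2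

end Residue

end UnramifiedDyadic

end Literature.IUT.LogVolume

end
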